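import Summits.BirchSwinnertonDyer.BirchSwinnertonDyer.Theorems.ByReductionTypeAtTwoMultUpperHalfTowerExpAddv4
import Summits.BirchSwinnertonDyer.BirchSwinnertonDyer.Theorems.ByReductionTypeAtTwoMultUpperHalfTowerFiltKernelAddv4
import HarnessLib

/-!
# Route `ByReductionTypeAtTwo`, crux `MultUpperHalfAtTwo` (item stmt-BirchSwinnertonDyer-19922): the EXPONENT-gap doors with EVERY local binder
# discharged — the four habitats at `v ∣ 2` (seat bsd-2adic-mult-2 GEN 11, part 2 of 2 of the doors)

HONEST FRAMING (cell `bsd-2adic`, run/shared/lean/pub/bsd-2adic/, HUMAN RULINGS D-0036 / D-0054 / D-0074): research route; THEOREMS ONLY;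
nothing is booked; BSD is not proved by any of this. PARTITION: X5@2 mult (K4ᵐ, B1·O1) × p = 2 — types-the-object-of; closes none.

= tower-1's `…MultUpperHalfTowerFiltKernelAddv4` §2 VERBATIM on the exponent door `MultTowerExp.towerGapAtTwo_of_exponent_cert_atTwo_addv4`:
`MultTowerExpKernel.towerGapAtTwo_of_exponent_cert_{nonsplitTwo, nonsplitTwo_oneBit, splitTwo_oneBit, splitTwo_zeroBit}_addv4`.
Each concludes `O1.TowerGapAtTwo W` from DECIDABLE per-curve data, the EXPONENT certificate `hstat` («`(conj_γ − id)^[b]` kills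
`Sel_{2^∞}(E/ℚ_n)[2]`», kit, displayed), the closed block bounds (`4 ≤ 2^t` / `2 ≤ 2^t` / —, `C_ℓ^{2^{min(n,e_ℓ)}} ≤ 2^t`) and
`b + t < 2ⁿ` — and NOTHING ELSE. WHAT IS DISPLAYED, NOT PROVED: the exponent certificate (ENGINE A + `S2| SIGMA`, evidence tier).
∀-LEVEL CONTENT: none.

References: R. Greenberg, LNM 1716 (1999) §§1, 3, 4; L. Washington, *Introduction to Cyclotomic Fields*, §13; J. Silverman, GTM 106 III.§2, VII,
GTM 151 IV–V.
-/

set_option autoImplicit false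
-- the Theorems namespace of this sub repeats the summit name by design (D-0017 nested layout: Summit.<S>.<Sub>)
set_option linter.dupNamespace false

noncomputable section

open scoped Classical MatrixGroups ModularForm

open NumberField IsDedekindDomain CongruenceSubgroup WeierstrassCurve Literature.NumberTheory.EllipticCurves
  Literature.NumberTheory.EllipticCurves.ModularForms
  Literature.NumberTheory.EllipticCurves.Greenberg1999
  Literature.NumberTheory.EllipticCurves.Rank1Residual
  Literature.NumberTheory.EllipticCurves.Rank1Residual.Typed
  Literature.NumberTheory.GaloisRepresentations
  Summit.BirchSwinnertonDyer.Rank1Residual.X5 Summit.BirchSwinnertonDyer.Rank1Residual.X5.O1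
  Summit.BirchSwinnertonDyer.Rank1Residual
  Summit.BirchSwinnertonDyer.BirchSwinnertonDyer.Theorems.KatoHalfPinch
  Summit.BirchSwinnertonDyer.BirchSwinnertonDyer.Theorems.MultTowerAddv
  Rat.HeightOneSpectrum

namespace Summit.BirchSwinnertonDyer.BirchSwinnertonDyer.Theorems.MultTowerExpKernel

/-! ## §2 The four habitats at the place over `2`, every local binder discharged, EIGHT disjuncts, EXPONENT criterion -/

section AtTwo

variable (W : WeierstrassCurve ℚ) [W.IsElliptic] [W.IsGloballyMinimal]

/-- **The EXPONENT GAP certificate, every local binder discharged, at a NON-SPLIT multiplicative `2`, two bits** (`C₂ = 4` from the KERNEL theorem `MultTowerCert.atTwo_le_four_of_nonsplit_kernel` = tower-1's `MultTowerNS2.twoTorsion_localTowerKerPrimary_le_four_nonsplitTwo`, Greenberg p. 93):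
block bounds `4 ≤ 2^t`, `C_ℓ^{2^{min(n, e_ℓ)}} ≤ 2^t`, and `b + t < 2ⁿ`. [cite: GreenbergLNM1716, §3, between Prop. 3.6 and 3.7 (PDF p. 93)]
[cite: SilvermanATAEC1994, IV.9 Table 4.1] -/
theorem towerGapAtTwo_of_exponent_cert_nonsplitTwo_addv4
    (hmult : W.HasMultiplicativeReductionAtPrime 2) (hns : ¬ W.HasSplitMultiplicativeReductionAtPrime 2)
    (htors : ¬ 2 ∣ W.torsionOrder) {n b t : ℕ} (hbt : b + t < 2 ^ n)
    (P : Finset ℕ) (hP : ∀ ℓ ∈ P, ℓ.Prime ∧ ℓ ≠ 2)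
    (hΔ : ∀ ℓ : ℕ, ℓ.Prime → ℓ ≠ 2 → (ℓ : ℤ) ∣ W.minimalDiscriminantInt → ℓ ∈ P)
    (C e k : ℕ → ℕ) (he : ∀ ℓ ∈ P, ¬ 2 ^ (e ℓ + 4) ∣ ℓ ^ 2 - 1)
    (hC : ∀ (ℓ : ℕ) [Fact ℓ.Prime], ℓ ∈ P →
      4 ≤ C ℓ ∨ (W.HasMultiplicativeReductionAtPrime ℓ ∧ 2 ≤ C ℓ) ∨
        (W.HasMultiplicativeReductionAtPrime ℓ ∧ (ℓ : ℤ) ^ k ℓ ∣ W.minimalDiscriminantInt ∧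
          ¬ (ℓ : ℤ) ^ (k ℓ + 1) ∣ W.minimalDiscriminantInt ∧ ¬ 2 ∣ k ℓ ∧ 1 ≤ C ℓ) ∨
        (¬ (ℓ : ℤ) ∣ W.minimalDiscriminantInt ∧ 1 ≤ C ℓ) ∨
        ((ℓ : ℤ) ∣ (integralModelInt W).c₄ ∧ (ℓ : ℤ) ^ k ℓ ∣ W.minimalDiscriminantInt ∧
          ¬ (ℓ : ℤ) ^ (k ℓ + 1) ∣ W.minimalDiscriminantInt ∧
          (k ℓ = 2 ∨ k ℓ = 4 ∨ k ℓ = 5 ∨ (7 ≤ k ℓ ∧ k ℓ ≠ 9 ∧ (ℓ : ℤ) ^ k ℓ ∣ (integralModelInt W).c₄ ^ 3)) ∧ 1 ≤ C ℓ) ∨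
        ((ℓ : ℤ) ∣ (integralModelInt W).c₄ ∧ (ℓ : ℤ) ^ k ℓ ∣ W.minimalDiscriminantInt ∧
          ¬ (ℓ : ℤ) ^ (k ℓ + 1) ∣ W.minimalDiscriminantInt ∧ 1 ≤ k ℓ ∧ k ℓ ≠ 6 ∧
          (ℓ : ℤ) ^ k ℓ ∣ (integralModelInt W).c₄ ^ 3 ∧ 2 ≤ C ℓ) ∨
        ((ℓ : ℤ) ∣ (integralModelInt W).c₄ ∧ (ℓ : ℤ) ^ k ℓ ∣ W.minimalDiscriminantInt ∧
          ¬ (ℓ : ℤ) ^ (k ℓ + 1) ∣ W.minimalDiscriminantInt ∧ ¬ 2 ∣ k ℓ ∧ 2 ≤ C ℓ) ∨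
        ((ℓ : ℤ) ∣ (integralModelInt W).c₄ ∧ (ℓ : ℤ) ∣ W.minimalDiscriminantInt ∧
          (∀ x : ZMod (ℓ ^ k ℓ), 4 * x ^ 3 + ((integralModelInt W).b₂ : ZMod (ℓ ^ k ℓ)) * x ^ 2 +
            2 * ((integralModelInt W).b₄ : ZMod (ℓ ^ k ℓ)) * x + ((integralModelInt W).b₆ : ZMod (ℓ ^ k ℓ)) ≠ 0) ∧
          1 ≤ C ℓ))
    (hstat : ∀ (κ : ZpExtension ℚ 2) (γ : Field.absoluteGaloisGroup ℚ), κ.IsCyclotomic →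
      κ.IsTopGenerator γ → ∀ z : W.selmerLayer κ n, 2 • z = 0 →
        (⇑(W.conjH1 2 (κ.layerSubgroup n) γ -
          AddMonoidHom.id (W.subgroupH1 2 (κ.layerSubgroup n))))^[b]
          (z : W.subgroupH1 2 (κ.layerSubgroup n)) = 0)
    (h2t : 4 ≤ 2 ^ t) (hexp : ∀ ℓ ∈ P, C ℓ ^ 2 ^ min n (e ℓ) ≤ 2 ^ t) : TowerGapAtTwo W :=
  MultTowerExp.towerGapAtTwo_of_exponent_cert_atTwo_addv4 W lemma33_localTowerKerPrimary_eq_bot_of_good_holds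
    lemma33_localTowerKerPrimary_cyclic_of_multiplicative_holds lemma33_natCard_localTowerKerPrimary_le_four_of_additive_holds htors hbt 4
    (MultTowerCert.atTwo_le_four_of_nonsplit_kernel W hmult hns n) P hP hΔ C e k he hC hstat h2t hexp

/-- **The EXPONENT GAP certificate, every local binder discharged, at a NON-SPLIT multiplicative `2`, ONE bit** (`C₂ = 2`, KERNEL: Tate unit `u_q ≡ ±3 (mod 8)` from the
decidable datum `Δ_min = 2^k u`, `c₄ = c`, `u c ≡ 3, 5 (mod 8)`; tower-1's `MultTowerNS2.atTwo_le_two_of_nonsplit_oneBit_kernel`, layer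
`n ≥ 1`): block bounds `2 ≤ 2^t`, `C_ℓ^{2^{min(n, e_ℓ)}} ≤ 2^t`, and `b + t < 2ⁿ`. [cite: GreenbergLNM1716, §3, between Prop. 3.6 and 3.7 (PDF p. 93)]
[cite: SilvermanATAEC1994, IV.9 Table 4.1] -/
theorem towerGapAtTwo_of_exponent_cert_nonsplitTwo_oneBit_addv4
    (hmult : W.HasMultiplicativeReductionAtPrime 2) (hns : ¬ W.HasSplitMultiplicativeReductionAtPrime 2)
    (hq : ∃ (k : ℕ) (u c : ℤ), W.minimalDiscriminantInt = 2 ^ k * u ∧ W.c₄ = (c : ℚ) ∧ (u * c % 8 = 3 ∨ u * c % 8 = 5))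
    (htors : ¬ 2 ∣ W.torsionOrder) {n b t : ℕ} (hn : 1 ≤ n) (hbt : b + t < 2 ^ n)
    (P : Finset ℕ) (hP : ∀ ℓ ∈ P, ℓ.Prime ∧ ℓ ≠ 2)
    (hΔ : ∀ ℓ : ℕ, ℓ.Prime → ℓ ≠ 2 → (ℓ : ℤ) ∣ W.minimalDiscriminantInt → ℓ ∈ P)
    (C e k : ℕ → ℕ) (he : ∀ ℓ ∈ P, ¬ 2 ^ (e ℓ + 4) ∣ ℓ ^ 2 - 1)
    (hC : ∀ (ℓ : ℕ) [Fact ℓ.Prime], ℓ ∈ P →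
      4 ≤ C ℓ ∨ (W.HasMultiplicativeReductionAtPrime ℓ ∧ 2 ≤ C ℓ) ∨
        (W.HasMultiplicativeReductionAtPrime ℓ ∧ (ℓ : ℤ) ^ k ℓ ∣ W.minimalDiscriminantInt ∧
          ¬ (ℓ : ℤ) ^ (k ℓ + 1) ∣ W.minimalDiscriminantInt ∧ ¬ 2 ∣ k ℓ ∧ 1 ≤ C ℓ) ∨
        (¬ (ℓ : ℤ) ∣ W.minimalDiscriminantInt ∧ 1 ≤ C ℓ) ∨
        ((ℓ : ℤ) ∣ (integralModelInt W).c₄ ∧ (ℓ : ℤ) ^ k ℓ ∣ W.minimalDiscriminantInt ∧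
          ¬ (ℓ : ℤ) ^ (k ℓ + 1) ∣ W.minimalDiscriminantInt ∧
          (k ℓ = 2 ∨ k ℓ = 4 ∨ k ℓ = 5 ∨ (7 ≤ k ℓ ∧ k ℓ ≠ 9 ∧ (ℓ : ℤ) ^ k ℓ ∣ (integralModelInt W).c₄ ^ 3)) ∧ 1 ≤ C ℓ) ∨
        ((ℓ : ℤ) ∣ (integralModelInt W).c₄ ∧ (ℓ : ℤ) ^ k ℓ ∣ W.minimalDiscriminantInt ∧
          ¬ (ℓ : ℤ) ^ (k ℓ + 1) ∣ W.minimalDiscriminantInt ∧ 1 ≤ k ℓ ∧ k ℓ ≠ 6 ∧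
          (ℓ : ℤ) ^ k ℓ ∣ (integralModelInt W).c₄ ^ 3 ∧ 2 ≤ C ℓ) ∨
        ((ℓ : ℤ) ∣ (integralModelInt W).c₄ ∧ (ℓ : ℤ) ^ k ℓ ∣ W.minimalDiscriminantInt ∧
          ¬ (ℓ : ℤ) ^ (k ℓ + 1) ∣ W.minimalDiscriminantInt ∧ ¬ 2 ∣ k ℓ ∧ 2 ≤ C ℓ) ∨
        ((ℓ : ℤ) ∣ (integralModelInt W).c₄ ∧ (ℓ : ℤ) ∣ W.minimalDiscriminantInt ∧
          (∀ x : ZMod (ℓ ^ k ℓ), 4 * x ^ 3 + ((integralModelInt W).b₂ : ZMod (ℓ ^ k ℓ)) * x ^ 2 +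
            2 * ((integralModelInt W).b₄ : ZMod (ℓ ^ k ℓ)) * x + ((integralModelInt W).b₆ : ZMod (ℓ ^ k ℓ)) ≠ 0) ∧
          1 ≤ C ℓ))
    (hstat : ∀ (κ : ZpExtension ℚ 2) (γ : Field.absoluteGaloisGroup ℚ), κ.IsCyclotomic →
      κ.IsTopGenerator γ → ∀ z : W.selmerLayer κ n, 2 • z = 0 →
        (⇑(W.conjH1 2 (κ.layerSubgroup n) γ -
          AddMonoidHom.id (W.subgroupH1 2 (κ.layerSubgroup n))))^[b]
          (z : W.subgroupH1 2 (κ.layerSubgroup n)) = 0)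
    (h2t : 2 ≤ 2 ^ t) (hexp : ∀ ℓ ∈ P, C ℓ ^ 2 ^ min n (e ℓ) ≤ 2 ^ t) : TowerGapAtTwo W :=
  MultTowerExp.towerGapAtTwo_of_exponent_cert_atTwo_addv4 W lemma33_localTowerKerPrimary_eq_bot_of_good_holds
    lemma33_localTowerKerPrimary_cyclic_of_multiplicative_holds lemma33_natCard_localTowerKerPrimary_le_four_of_additive_holds htors hbt 2
    (MultTowerNS2.atTwo_le_two_of_nonsplit_oneBit_kernel W hmult hns hq hn) P hP hΔ C e k he hC hstat h2t hexp

/-- **The EXPONENT GAP certificate, every local binder discharged, at a SPLIT multiplicative `2`, ONE bit** (`C₂ = 2`, KERNEL: `MultTowerCert.atTwo_le_two_of_split_oneBit_kernel`,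
Greenberg pp. 91–92 as tower-1's theorem `hSP1_holds`): block bounds `2 ≤ 2^t`, `C_ℓ^{2^{min(n, e_ℓ)}} ≤ 2^t`, and `b + t < 2ⁿ`.
[cite: GreenbergLNM1716, §3, between Prop. 3.6 and 3.7 (PDF pp. 91–93)] [cite: SilvermanATAEC1994, IV.9 Table 4.1] -/
theorem towerGapAtTwo_of_exponent_cert_splitTwo_oneBit_addv4
    (hsplit : W.HasSplitMultiplicativeReductionAtPrime 2)
    (htors : ¬ 2 ∣ W.torsionOrder) {n b t : ℕ} (hbt : b + t < 2 ^ n)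
    (P : Finset ℕ) (hP : ∀ ℓ ∈ P, ℓ.Prime ∧ ℓ ≠ 2)
    (hΔ : ∀ ℓ : ℕ, ℓ.Prime → ℓ ≠ 2 → (ℓ : ℤ) ∣ W.minimalDiscriminantInt → ℓ ∈ P)
    (C e k : ℕ → ℕ) (he : ∀ ℓ ∈ P, ¬ 2 ^ (e ℓ + 4) ∣ ℓ ^ 2 - 1)
    (hC : ∀ (ℓ : ℕ) [Fact ℓ.Prime], ℓ ∈ P →
      4 ≤ C ℓ ∨ (W.HasMultiplicativeReductionAtPrime ℓ ∧ 2 ≤ C ℓ) ∨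
        (W.HasMultiplicativeReductionAtPrime ℓ ∧ (ℓ : ℤ) ^ k ℓ ∣ W.minimalDiscriminantInt ∧
          ¬ (ℓ : ℤ) ^ (k ℓ + 1) ∣ W.minimalDiscriminantInt ∧ ¬ 2 ∣ k ℓ ∧ 1 ≤ C ℓ) ∨
        (¬ (ℓ : ℤ) ∣ W.minimalDiscriminantInt ∧ 1 ≤ C ℓ) ∨
        ((ℓ : ℤ) ∣ (integralModelInt W).c₄ ∧ (ℓ : ℤ) ^ k ℓ ∣ W.minimalDiscriminantInt ∧
          ¬ (ℓ : ℤ) ^ (k ℓ + 1) ∣ W.minimalDiscriminantInt ∧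
          (k ℓ = 2 ∨ k ℓ = 4 ∨ k ℓ = 5 ∨ (7 ≤ k ℓ ∧ k ℓ ≠ 9 ∧ (ℓ : ℤ) ^ k ℓ ∣ (integralModelInt W).c₄ ^ 3)) ∧ 1 ≤ C ℓ) ∨
        ((ℓ : ℤ) ∣ (integralModelInt W).c₄ ∧ (ℓ : ℤ) ^ k ℓ ∣ W.minimalDiscriminantInt ∧
          ¬ (ℓ : ℤ) ^ (k ℓ + 1) ∣ W.minimalDiscriminantInt ∧ 1 ≤ k ℓ ∧ k ℓ ≠ 6 ∧
          (ℓ : ℤ) ^ k ℓ ∣ (integralModelInt W).c₄ ^ 3 ∧ 2 ≤ C ℓ) ∨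
        ((ℓ : ℤ) ∣ (integralModelInt W).c₄ ∧ (ℓ : ℤ) ^ k ℓ ∣ W.minimalDiscriminantInt ∧
          ¬ (ℓ : ℤ) ^ (k ℓ + 1) ∣ W.minimalDiscriminantInt ∧ ¬ 2 ∣ k ℓ ∧ 2 ≤ C ℓ) ∨
        ((ℓ : ℤ) ∣ (integralModelInt W).c₄ ∧ (ℓ : ℤ) ∣ W.minimalDiscriminantInt ∧
          (∀ x : ZMod (ℓ ^ k ℓ), 4 * x ^ 3 + ((integralModelInt W).b₂ : ZMod (ℓ ^ k ℓ)) * x ^ 2 +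
            2 * ((integralModelInt W).b₄ : ZMod (ℓ ^ k ℓ)) * x + ((integralModelInt W).b₆ : ZMod (ℓ ^ k ℓ)) ≠ 0) ∧
          1 ≤ C ℓ))
    (hstat : ∀ (κ : ZpExtension ℚ 2) (γ : Field.absoluteGaloisGroup ℚ), κ.IsCyclotomic →
      κ.IsTopGenerator γ → ∀ z : W.selmerLayer κ n, 2 • z = 0 →
        (⇑(W.conjH1 2 (κ.layerSubgroup n) γ -
          AddMonoidHom.id (W.subgroupH1 2 (κ.layerSubgroup n))))^[b]
          (z : W.subgroupH1 2 (κ.layerSubgroup n)) = 0)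
    (h2t : 2 ≤ 2 ^ t) (hexp : ∀ ℓ ∈ P, C ℓ ^ 2 ^ min n (e ℓ) ≤ 2 ^ t) : TowerGapAtTwo W :=
  MultTowerExp.towerGapAtTwo_of_exponent_cert_atTwo_addv4 W lemma33_localTowerKerPrimary_eq_bot_of_good_holds
    lemma33_localTowerKerPrimary_cyclic_of_multiplicative_holds lemma33_natCard_localTowerKerPrimary_le_four_of_additive_holds htors hbt 2
    (MultTowerCert.atTwo_le_two_of_split_oneBit_kernel W hsplit n) P hP hΔ C e k he hC hstat h2t hexp

/-- **The EXPONENT GAP certificate, every local binder discharged, at a SPLIT multiplicative `2`, ZERO bits** (`C₂ = 1`, KERNEL: Tate unit `u_q ≡ ±3 (mod 8)` from the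
decidable datum, tower-1's `MultTowerCert.atTwo_le_one_of_split_zeroBit_kernel`): block bounds `C_ℓ^{2^{min(n, e_ℓ)}} ≤ 2^t` and `b + t < 2ⁿ`.
[cite: GreenbergLNM1716, §3, between Prop. 3.6 and 3.7 (PDF p. 93)] [cite: SilvermanATAEC1994, IV.9 Table 4.1] -/
theorem towerGapAtTwo_of_exponent_cert_splitTwo_zeroBit_addv4
    (hsplit : W.HasSplitMultiplicativeReductionAtPrime 2)
    (htu : ∃ (k : ℕ) (u c : ℤ), W.minimalDiscriminantInt = 2 ^ k * u ∧ W.c₄ = (c : ℚ) ∧ (u * c % 8 = 3 ∨ u * c % 8 = 5))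
    (htors : ¬ 2 ∣ W.torsionOrder) {n b t : ℕ} (hbt : b + t < 2 ^ n)
    (P : Finset ℕ) (hP : ∀ ℓ ∈ P, ℓ.Prime ∧ ℓ ≠ 2)
    (hΔ : ∀ ℓ : ℕ, ℓ.Prime → ℓ ≠ 2 → (ℓ : ℤ) ∣ W.minimalDiscriminantInt → ℓ ∈ P)
    (C e k : ℕ → ℕ) (he : ∀ ℓ ∈ P, ¬ 2 ^ (e ℓ + 4) ∣ ℓ ^ 2 - 1)
    (hC : ∀ (ℓ : ℕ) [Fact ℓ.Prime], ℓ ∈ P →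
      4 ≤ C ℓ ∨ (W.HasMultiplicativeReductionAtPrime ℓ ∧ 2 ≤ C ℓ) ∨
        (W.HasMultiplicativeReductionAtPrime ℓ ∧ (ℓ : ℤ) ^ k ℓ ∣ W.minimalDiscriminantInt ∧
          ¬ (ℓ : ℤ) ^ (k ℓ + 1) ∣ W.minimalDiscriminantInt ∧ ¬ 2 ∣ k ℓ ∧ 1 ≤ C ℓ) ∨
        (¬ (ℓ : ℤ) ∣ W.minimalDiscriminantInt ∧ 1 ≤ C ℓ) ∨
        ((ℓ : ℤ) ∣ (integralModelInt W).c₄ ∧ (ℓ : ℤ) ^ k ℓ ∣ W.minimalDiscriminantInt ∧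
          ¬ (ℓ : ℤ) ^ (k ℓ + 1) ∣ W.minimalDiscriminantInt ∧
          (k ℓ = 2 ∨ k ℓ = 4 ∨ k ℓ = 5 ∨ (7 ≤ k ℓ ∧ k ℓ ≠ 9 ∧ (ℓ : ℤ) ^ k ℓ ∣ (integralModelInt W).c₄ ^ 3)) ∧ 1 ≤ C ℓ) ∨
        ((ℓ : ℤ) ∣ (integralModelInt W).c₄ ∧ (ℓ : ℤ) ^ k ℓ ∣ W.minimalDiscriminantInt ∧
          ¬ (ℓ : ℤ) ^ (k ℓ + 1) ∣ W.minimalDiscriminantInt ∧ 1 ≤ k ℓ ∧ k ℓ ≠ 6 ∧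
          (ℓ : ℤ) ^ k ℓ ∣ (integralModelInt W).c₄ ^ 3 ∧ 2 ≤ C ℓ) ∨
        ((ℓ : ℤ) ∣ (integralModelInt W).c₄ ∧ (ℓ : ℤ) ^ k ℓ ∣ W.minimalDiscriminantInt ∧
          ¬ (ℓ : ℤ) ^ (k ℓ + 1) ∣ W.minimalDiscriminantInt ∧ ¬ 2 ∣ k ℓ ∧ 2 ≤ C ℓ) ∨
        ((ℓ : ℤ) ∣ (integralModelInt W).c₄ ∧ (ℓ : ℤ) ∣ W.minimalDiscriminantInt ∧
          (∀ x : ZMod (ℓ ^ k ℓ), 4 * x ^ 3 + ((integralModelInt W).b₂ : ZMod (ℓ ^ k ℓ)) * x ^ 2 +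
            2 * ((integralModelInt W).b₄ : ZMod (ℓ ^ k ℓ)) * x + ((integralModelInt W).b₆ : ZMod (ℓ ^ k ℓ)) ≠ 0) ∧
          1 ≤ C ℓ))
    (hstat : ∀ (κ : ZpExtension ℚ 2) (γ : Field.absoluteGaloisGroup ℚ), κ.IsCyclotomic →
      κ.IsTopGenerator γ → ∀ z : W.selmerLayer κ n, 2 • z = 0 →
        (⇑(W.conjH1 2 (κ.layerSubgroup n) γ -
          AddMonoidHom.id (W.subgroupH1 2 (κ.layerSubgroup n))))^[b]
          (z : W.subgroupH1 2 (κ.layerSubgroup n)) = 0)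
    (hexp : ∀ ℓ ∈ P, C ℓ ^ 2 ^ min n (e ℓ) ≤ 2 ^ t) : TowerGapAtTwo W :=
  MultTowerExp.towerGapAtTwo_of_exponent_cert_atTwo_addv4 W lemma33_localTowerKerPrimary_eq_bot_of_good_holds
    lemma33_localTowerKerPrimary_cyclic_of_multiplicative_holds lemma33_natCard_localTowerKerPrimary_le_four_of_additive_holds htors hbt 1
    (MultTowerCert.atTwo_le_one_of_split_zeroBit_kernel W hsplit htu n) P hP hΔ C e k he hC hstat Nat.one_le_two_pow hexp

end AtTwo

end Summit.BirchSwinnertonDyer.BirchSwinnertonDyer.Theorems.MultTowerExpKernel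

end
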